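import Literature.MathematicalPhysics.QuantumFieldTheory.Balaban1983to89.HaarDensitySpecialUnitaryGlobalPi
import Literature.MathematicalPhysics.QuantumFieldTheory.Balaban1983to89.B10Eq18SigmaSU2Chart

/-!
# `Balaban1983to89.Sigma0SU2TwinBridge` — [Balaban1985UV3] p. 260 «σ₀ = σ(0) … For example for SU(2) we have
# σ(A) = 1/2π² (sin|A|/|A|)²»: THE CELL'S GLOBAL `SU(N)` CONSTANT `HaarDensitySpecialUnitaryGlobal.sigma0 η μ` AND
# ONE-BOND COORDINATE MEASURE `coordMeasure η μ` (p28, alcove domain `Ω ⊆ 𝔰𝔲(N)`) EVALUATED AT PRINT'S EXAMPLE `N = 2`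
# — `Ω = {|A| < π}` in the Pauli coordinates, `∫_Ω |det jac| d³A = 2π²`, **`σ₀ = 1/2π² = σ_{SU(2)}(0)`**,
# `coordMeasure = σ_{SU(2)}(|A|) 1_{|A|<π} d³A` — a steward twin bridge between the `SU(N)` lineage (p28) and the
# `SU(2)` lineage (r07 `B10Eq18SigmaSU2Haar` / `…Window` / `…Chart`)

statement-level skeleton of published theorems with citation tags; proofs where landed; nothing here is a claim
about the Yang–Mills mass gap

Mega-formalization `lit-balaban` (HOME `run/shared/lean/pub/lit-balaban/`), unit `lit-balaban-r20` gen 41 (B12 fold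
owner / DEFINITIONS steward; free-target protocol G.5-34(d), TAKING 2026-08-23T07:17Z, r07 g48 «no objection — not mine,
welcome»; steward ruling G.5-1 «keep both, bridge»).  Register pair of `lit-balaban-r20/DEFINITIONS.md`: **H34** «σ₀ at
print's SU(2) example» (opened and bridged by this file; sibling of **H30** «σ₀ for U(N)») — p28's named constant
`HaarDensitySpecialUnitaryGlobal.sigma0 η μ := (μ(SU(N)) / ∫_Ω |det jac| dη).toNNReal` (`HaarDensitySpecialUnitaryGlobalPi`,
p355547) ⟷ r07's `B10Eq22Rescaling.sigmaSU2 0 = 1/2π²` (`B10Eq18SigmaSU2Haar`, p319434 ff.), recorded in DEFINITIONS v1.44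
as «LOCATED, no pair opened: sigma0 η μ = 1/(2π²) for N = 2 … NOT derived».  THIS FILE derives it.

CITATION HEADER.  [Balaban1985UV3] T. Bałaban, *Ultraviolet stability of three-dimensional lattice pure gauge field
theories*, Commun. Math. Phys. **102** (1985) 255–275, p. 260 (held: `paper:balaban1985-cmp102-uv-stability-3d`, PDF
p. 6): *«we express the Haar measure dU′ as dU′ = σ(A′)dA′ = σ₀ σ/σ₀ (A′)dA′, σ₀ = σ(0), where dA′ is the Lebesque measure
on 𝔤, and σ(A′) is a density which can be calculated explicitly for all classical groups. For example for SU(2) we have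
σ(A) = 1/2π² (sin|A|/|A|)², where |A| = Σ_{a=1}^{3} (A^a)² ⟦sic⟧, and an element A of the Lie algebra is represented as
A = Σ_{a=1}^{3} σ_aA^a, σ_a are the three Pauli matrices»*.  [Helgason2000] S. Helgason, *Groups and Geometric Analysis*,
Ch. I §1 Thm. 1.14 (13) p. 96 (the exponential-coordinates formula whose normalising constant `σ₀` is).

STATE OF THE TREE.  p28's `SU(N)` lineage (`SpecialUnitaryAlcove` p352854: the alcove `Ω = alcove n = {A ∈ 𝔰𝔲(N) : ∃ c,
‖A − icI‖ < π}`; `HaarDensitySpecialUnitaryGlobal` p355225: `∫_{SU(N)} F dμ = (μ(SU(N))/∫_Ω |det jac| dη) ∫_Ω F(e^A)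
|det jac A| dη(A)` for EVERY Haar `μ`, EVERY additive Haar `η` on `𝔰𝔲(N)`; `HaarDensitySpecialUnitaryGlobalPi` p355547:
the constant as a number `sigma0 η μ`, the one-bond measure `coordMeasure η μ = σ₀ • |det jac| dη|_Ω`,
`Θ_*(coordMeasure) = μ`) leaves `σ₀` «identified, not evaluated» (HONEST SCOPE (ii) of both files; `B12-CLOSURE.md`
Amendment gen 40 (b) residual α).  r07's `SU(2)` lineage in print's Pauli letters (`B10Eq18SigmaSU2Haar`: `∫ F dU =
∫_{|A|<π} F(exp iA) σ_{SU(2)}(|A|) d³A`, `sigmaMeasure = σ_{SU(2)}(|A|)1_{|A|<π}d³A`, `(exp i·)_* sigmaMeasure = dU`;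
`B10Eq18SigmaSU2Window`: `∫_{|A|<s} σ/σ₀ d³A = 2π(s − sin s cos s)`; `B10Eq18SigmaSU2Chart` (r07 g19): the Pauli
coordinates land in `C.lie`, `C := specialUnitaryLogChart (Fin 2)`, isometrically, `jacDensity(iΣσ_aA^a) = σ(|A|)/σ₀`,
`Θ(iΣσ_aA^a) = exp iA`, and p28's WINDOW constant `dU(V_s)/∫_{B(0,s)}|det jac| dη = 1/2π²` for the framework's windows
`0 < s ≤ log(4/3)`) stops at the windows: the alcove `Ω`, p28's global constant `sigma0` and `coordMeasure` (which landed
AFTER r07 g19) are not touched there.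

WHAT IS PROVED (theorems only; 0 definitions, 0 named facts, 0 sorry).  Throughout `η_P := Measure.map (A ↦ ⟨iΣσ_aA^a⟩)
volume` is Lebesgue measure `d³A` transported to `C.lie` by the Pauli coordinates («dA′ is the Lebesque measure on 𝔤»
in the coordinates `A^a`; r07's inline measure) and `dU := haarProbability SU(2)`; both written out in every statement.
* §1 **THE ALCOVE IS PRINT'S INJECTIVITY BALL: `iΣσ_aA^a ∈ Ω ↔ |A| < π`** (`pauli_mem_alcove_iff`), `(Pauli)⁻¹(Ω) =
  {|A| < π}` (`preimage_pauli_alcove`), `Ω = Pauli({|A| < π})` (`alcove_eq_image_pauli_ball`) — from the two eigenvalues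
  `±|A|` of `Σσ_aA^a` (`abs_eigenvalues_pauli`: `|θ_j| = |A|`, via the tree's `UnitaryLogSpectralForm.norm_sub_smul_one_lt_iff`
  / `trace_eq_I_mul_sum_eigenvalues` and r07's isometry `norm_su2Coord`) — new content: for `N = 2` the re-centring
  freedom `c` of the alcove buys nothing;
* §2 **`∫_Ω |det jac| dη_P = 2π²`** (`lintegral_jacDensity_alcove_pauli`; r07's `jacDensity_pauli` +
  `lintegral_sigmaRatio_ball_eq` at `s = π`), also with p28's explicit density `Π_jΠ_k sinc((θ_j − θ_k)/2)`
  (`lintegral_prod_sinc_alcove_pauli`);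
* §3 **`σ₀ = 1/2π²`**: `(sigma0 η_P dU : ℝ≥0∞) = ofReal (1/2π²)` (`coe_sigma0_pauli`), `(sigma0 η_P dU : ℝ) = 1/(2π²)`
  (`sigma0_pauli_eq`), and **«σ₀ = σ(0)» BETWEEN THE TWO LINEAGES: `sigma0 η_P dU = σ_{SU(2)}(0)`**
  (`sigma0_pauli_eq_sigmaSU2_zero`, r07's `B10Eq22Rescaling.sigmaSU2`);
* §4 **THE TWO CELLS' ONE-BOND COORDINATE MEASURES ARE ONE MEASURE: `coordMeasure η_P dU = (Pauli)_* sigmaMeasure`**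
  (`coordMeasure_pauli_eq_map_sigmaMeasure`) — p28's `σ₀ • |det jac| dη|_Ω` is r07's `σ_{SU(2)}(|A|) 1_{|A|<π} d³A`;
* §5 p28's GLOBAL theorems AT `N = 2` WITH THE CONSTANT EVALUATED, and agreement of the two routes ON THE WHOLE GROUP:
  `∫ F dU = (1/2π²) ∫_Ω F(Θ X)|det jac X| dη_P(X)` (`lintegral_haarProbability_su2_eq_alcove`, from p28's
  `lintegral_haar_specialUnitaryGroup_eq` by name; explicit-density form `lintegral_haarProbability_su2_eq_prod_sinc` from
  p28's `lintegral_haarProbability_specialUnitaryGroup_eq_prod_sinc`), `= ∫_{|A|<π} F(exp iA) σ_{SU(2)}(|A|) d³A`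
  (`lintegral_haarProbability_su2_eq_pauli_of_alcove`: r07's `lintegral_haarProbability_eq_pauli` RE-DERIVED through
  p28's route), and p28's `Θ_*(coordMeasure) = dU` at `N = 2` read through §4 is r07's `(exp i·)_* sigmaMeasure = dU`
  (`map_expPauli_sigmaMeasure_of_coordMeasure`).

HONEST SCOPE.  (i) `N = 2` only: print evaluates `σ₀` for `SU(2)` only, and so does the tree (for `N ≥ 3` p28's
`sigma0 η μ` stays identified-not-evaluated; no closed form is printed).  (ii) `η_P` is Lebesgue measure in print's
coordinates `A^a` (NOT the trace-form-orthonormal coordinates of `M₂(ℂ)`, which differ by `√2` per axis); `dU` is the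
normalised Haar measure (`haarProbability`, total mass `1`) — print's `dU′`.  (iii) Everything about `SU(2)` comes BY
NAME from r07's files (ultimately pub-balaban's `T4HaarSU2ExpChart`), everything about the alcove / `sigma0` /
`coordMeasure` BY NAME from p28's files 4, 6, 7; nothing of either lineage is re-proved or restated; the only new
computation is §1 (two eigenvalues `±|A|`).  (iv) The Borel structure on `C.lie` is a hypothesis `[MeasurableSpace]
[BorelSpace]` exactly as in both lineages (no instance is declared).  Failed printed steps: none (HOME/GAPS.md unchanged).

## References
* T. Bałaban, *Ultraviolet stability of three-dimensional lattice pure gauge field theories*, Commun. Math. Phys.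
  **102** (1985) 255–275, p. 260. [Balaban1985UV3]
* S. Helgason, *Groups and Geometric Analysis*, AMS (2000), Ch. I §1 Thm. 1.14 (13) p. 96. [Helgason2000]
-/

noncomputable section

open MeasureTheory MeasureTheory.Measure Set Metric NormedSpace Complex
open scoped ENNReal NNReal Matrix.Norms.L2Operator

namespace Literature.MathematicalPhysics.QuantumFieldTheory.Balaban1983to89.Sigma0SU2TwinBridge

open Literature.MathematicalPhysics.QuantumLattice (fundamentalRep)
open Literature.MathematicalPhysics.QuantumFieldTheory (haarProbability)
open B10Eq18SigmaSU2 B10Eq22Rescaling B10Eq18SigmaSU2Haar B10Eq18SigmaSU2Window B10Eq18SigmaSU2Chart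
open HaarExponentialChart HaarExponentialChart.IsChartRep
open SpecialUnitaryAlcove UnitaryLogSpectralForm
open HaarDensityUnitaryChart (conjTranspose_eq_neg_of_mem_unitaryLogChart conjTranspose_eq_neg_of_mem_specialUnitaryLogChart)
open HaarDensityUnitaryExplicit (isHermitian_neg_I_smul)
open HaarDensitySpecialUnitaryGlobal (sigma0 coe_sigma0 coordMeasure map_expChart_coordMeasure
  lintegral_haar_specialUnitaryGroup_eq)

/-! ## §1  The alcove `Ω ⊆ 𝔰𝔲(2)` is print's injectivity ball `{|A| < π}` in the Pauli coordinates -/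

section Alcove

/-- `tr(iΣσ_aA^a) = 0` (`𝔰𝔲(2)` is traceless). [cite: Balaban1985UV3, p. 260] -/
theorem trace_su2Coord (A : EuclideanSpace ℝ (Fin 3)) : (su2Coord A).trace = 0 :=
  (mem_specialUnitaryLogChart_lie.1 (su2Coord_mem_lie A)).2

/-- The two eigenvalues `θ₀, θ₁` of the Hermitian matrix `Σσ_aA^a = −i·(iΣσ_aA^a)` sum to zero (`tr = i(θ₀ + θ₁) = 0`).
[cite: Balaban1985UV3, p. 260] [cite: Balaban1985Averaging, (22)–(23) p. 21] -/
theorem eigenvalues_pauli_add (A : EuclideanSpace ℝ (Fin 3)) :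
    (isHermitian_neg_I_smul (conjTranspose_eq_neg_of_mem_unitaryLogChart
        (toUnitaryLie (⟨su2Coord A, su2Coord_mem_lie A⟩ : (specialUnitaryLogChart (Fin 2)).lie)))).eigenvalues 0 +
      (isHermitian_neg_I_smul (conjTranspose_eq_neg_of_mem_unitaryLogChart
        (toUnitaryLie (⟨su2Coord A, su2Coord_mem_lie A⟩ : (specialUnitaryLogChart (Fin 2)).lie)))).eigenvalues 1 = 0 := by
  have h := trace_eq_I_mul_sum_eigenvalues
    (toUnitaryLie (⟨su2Coord A, su2Coord_mem_lie A⟩ : (specialUnitaryLogChart (Fin 2)).lie))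
  rw [Fin.sum_univ_two] at h
  have h0 : ((toUnitaryLie (⟨su2Coord A, su2Coord_mem_lie A⟩ : (specialUnitaryLogChart (Fin 2)).lie) :
      (unitaryLogChart (Fin 2)).lie) : Matrix (Fin 2) (Fin 2) ℂ).trace = 0 := trace_su2Coord A
  rw [h0] at h
  have h1 := (mul_eq_zero.1 h.symm).resolve_left I_ne_zero
  exact_mod_cast h1

/-- **The eigenvalues of `Σσ_aA^a` are `±|A|`: `|θ_j| = |A|` for both `j`** — from `θ₀ + θ₁ = 0` and the tree's
`‖X − icI‖ < r ↔ ∀ j, |θ_j − c| < r` at `c = 0` together with r07's isometry `‖iΣσ_aA^a‖ = |A|`.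
[cite: Balaban1985UV3, p. 260] [cite: Balaban1985Averaging, (22)–(23) p. 21] -/
theorem abs_eigenvalues_pauli (A : EuclideanSpace ℝ (Fin 3)) (j : Fin 2) :
    |(isHermitian_neg_I_smul (conjTranspose_eq_neg_of_mem_unitaryLogChart
        (toUnitaryLie (⟨su2Coord A, su2Coord_mem_lie A⟩ : (specialUnitaryLogChart (Fin 2)).lie)))).eigenvalues j| = ‖A‖ := by
  set θ := (isHermitian_neg_I_smul (conjTranspose_eq_neg_of_mem_unitaryLogChart
        (toUnitaryLie (⟨su2Coord A, su2Coord_mem_lie A⟩ : (specialUnitaryLogChart (Fin 2)).lie)))).eigenvalues with hθ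
  -- the norm characterisation at `c = 0`: `|A| < r ↔ ∀ j, |θ_j| < r`
  have hiff : ∀ {r : ℝ}, 0 < r → (‖A‖ < r ↔ ∀ k, |θ k| < r) := by
    intro r hr
    have h := norm_sub_smul_one_lt_iff
      (toUnitaryLie (⟨su2Coord A, su2Coord_mem_lie A⟩ : (specialUnitaryLogChart (Fin 2)).lie)) 0 hr
    simp only [Complex.ofReal_zero, zero_mul, zero_smul, sub_zero] at h
    have hn : ‖((toUnitaryLie (⟨su2Coord A, su2Coord_mem_lie A⟩ : (specialUnitaryLogChart (Fin 2)).lie) :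
        (unitaryLogChart (Fin 2)).lie) : Matrix (Fin 2) (Fin 2) ℂ)‖ = ‖A‖ := norm_su2Coord A
    rw [hn] at h
    exact h
  -- both absolute values coincide (`θ₁ = −θ₀`)
  have hsum : θ 0 + θ 1 = 0 := eigenvalues_pauli_add A
  have h10 : θ 1 = -θ 0 := by linarith
  have habs : ∀ k, |θ k| = |θ 0| :=
    Fin.forall_fin_two.2 ⟨rfl, by rw [h10, abs_neg]⟩
  rw [habs j]
  apply le_antisymm
  · -- `|θ₀| ≤ |A|`: otherwise `|A| < |θ₀|` gives `|θ₀| < |θ₀|`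
    by_contra hlt
    push Not at hlt
    have hpos : 0 < |θ 0| := lt_of_le_of_lt (norm_nonneg A) hlt
    have := (hiff hpos).1 hlt 0
    exact lt_irrefl _ this
  · -- `|A| ≤ |θ₀|`: otherwise `|θ_k| < |A|` for both `k` gives `|A| < |A|`
    by_contra hlt
    push Not at hlt
    have hpos : 0 < ‖A‖ := lt_of_le_of_lt (abs_nonneg _) hlt
    have hall : ∀ k, |θ k| < ‖A‖ := fun k => by rw [habs k]; exact hlt
    exact lt_irrefl _ ((hiff hpos).2 hall)

/-- **THE ALCOVE IS PRINT'S INJECTIVITY BALL: `iΣσ_aA^a ∈ Ω ↔ |A| < π`** — for `N = 2` the eigenvalues are `±|A|`, so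
«all eigenvalues in SOME window of length `2π`» (`∃ c, ‖X − icI‖ < π`) already forces the centred window.
[cite: Balaban1985UV3, p. 260] [cite: Balaban1985Averaging, (22)–(23) p. 21] -/
theorem pauli_mem_alcove_iff (A : EuclideanSpace ℝ (Fin 3)) :
    (⟨su2Coord A, su2Coord_mem_lie A⟩ : (specialUnitaryLogChart (Fin 2)).lie) ∈ alcove (Fin 2) ↔ ‖A‖ < Real.pi := by
  constructor
  · intro hA
    obtain ⟨c, hc⟩ := (mem_alcove_iff _).1 hA
    have h := (norm_sub_smul_one_lt_iff
      (toUnitaryLie (⟨su2Coord A, su2Coord_mem_lie A⟩ : (specialUnitaryLogChart (Fin 2)).lie)) c Real.pi_pos).1 hc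
    set θ := (isHermitian_neg_I_smul (conjTranspose_eq_neg_of_mem_unitaryLogChart
        (toUnitaryLie (⟨su2Coord A, su2Coord_mem_lie A⟩ : (specialUnitaryLogChart (Fin 2)).lie)))).eigenvalues with hθ
    have h0 := h 0
    have h1 := h 1
    have hsum : θ 0 + θ 1 = 0 := eigenvalues_pauli_add A
    have habs : |θ 0| = ‖A‖ := abs_eigenvalues_pauli A 0
    -- `2|θ₀| = |(θ₀ − c) − (θ₁ − c)| ≤ |θ₀ − c| + |θ₁ − c| < 2π`
    have h2 : |θ 0 - c - (θ 1 - c)| < Real.pi + Real.pi :=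
      lt_of_le_of_lt (abs_sub _ _) (add_lt_add h0 h1)
    have h3 : θ 0 - c - (θ 1 - c) = 2 * θ 0 := by linarith
    rw [h3, abs_mul, abs_two, habs] at h2
    linarith
  · intro hA
    apply ball_subset_alcove
    rw [mem_ball_zero_iff, norm_pauli]
    exact hA

/-- `(Pauli)⁻¹(Ω) = {|A| < π}`. [cite: Balaban1985UV3, p. 260] [cite: Balaban1985Averaging, (22)–(23) p. 21] -/
theorem preimage_pauli_alcove :
    (fun A : EuclideanSpace ℝ (Fin 3) => (⟨su2Coord A, su2Coord_mem_lie A⟩ : (specialUnitaryLogChart (Fin 2)).lie)) ⁻¹'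
        alcove (Fin 2) = ball (0 : EuclideanSpace ℝ (Fin 3)) Real.pi := by
  ext A
  rw [mem_preimage, pauli_mem_alcove_iff, mem_ball_zero_iff]

/-- **`Ω = {iΣσ_aA^a : |A| < π}`**: the alcove of `𝔰𝔲(2)` is the image of print's ball under the Pauli coordinates (the
chart ball `B(0, π) ⊆ C.lie` of r07's `ball_lie_eq_image` at `s = π`).
[cite: Balaban1985UV3, p. 260] [cite: Balaban1985Averaging, (22)–(23) p. 21] -/
theorem alcove_eq_image_pauli_ball :
    alcove (Fin 2) =
      (fun A : EuclideanSpace ℝ (Fin 3) => (⟨su2Coord A, su2Coord_mem_lie A⟩ : (specialUnitaryLogChart (Fin 2)).lie)) ''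
        ball (0 : EuclideanSpace ℝ (Fin 3)) Real.pi := by
  ext X
  constructor
  · intro hX
    obtain ⟨x, hx⟩ := exists_su2Coord_eq_of_mem_lie X.2
    have hX' : (⟨su2Coord (WithLp.toLp 2 x), su2Coord_mem_lie _⟩ : (specialUnitaryLogChart (Fin 2)).lie) = X :=
      Subtype.ext hx
    refine ⟨WithLp.toLp 2 x, ?_, hX'⟩
    rw [mem_ball_zero_iff, ← pauli_mem_alcove_iff, hX']
    exact hX
  · rintro ⟨A, hA, rfl⟩
    exact (pauli_mem_alcove_iff A).2 (mem_ball_zero_iff.1 hA)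

/-- `Ω = B(0, π)`, the chart ball of `C.lie` of radius `π`. [cite: Balaban1985UV3, p. 260]
[cite: Balaban1985Averaging, (22)–(23) p. 21] -/
theorem alcove_eq_ball : alcove (Fin 2) = ball (0 : (specialUnitaryLogChart (Fin 2)).lie) Real.pi := by
  rw [alcove_eq_image_pauli_ball, ball_lie_eq_image]

end Alcove

/-! ## §2  `∫_Ω |det jac| dη_P = 2π²` -/

section Integral

variable [MeasurableSpace (specialUnitaryLogChart (Fin 2)).lie] [BorelSpace (specialUnitaryLogChart (Fin 2)).lie]

/-- **`∫_Ω |det jac X| dη_P(X) = ∫_{|A|<π} σ_{SU(2)}(|A|)/σ₀ d³A = 2π²`** (`η_P` = Lebesgue measure in the Pauli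
coordinates; r07's `jacDensity_pauli` and `∫_{|A|<s} σ/σ₀ = 2π(s − sin s cos s)` at `s = π`).
[cite: Balaban1985UV3, p. 260] [cite: Helgason2000, Ch. I §1 Thm. 1.14 (13) p. 96] -/
theorem lintegral_jacDensity_alcove_pauli :
    ∫⁻ X in alcove (Fin 2), jacDensity (lie_adStable_specialUnitaryGroup (n := Fin 2)) X
        ∂(Measure.map (fun A : EuclideanSpace ℝ (Fin 3) =>
          (⟨su2Coord A, su2Coord_mem_lie A⟩ : (specialUnitaryLogChart (Fin 2)).lie)) volume) =
      ENNReal.ofReal (2 * Real.pi ^ 2) := by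
  rw [setLIntegral_map measurableSet_alcove (measurable_jacDensity (lie_adStable_specialUnitaryGroup (n := Fin 2)))
    measurable_pauli, preimage_pauli_alcove]
  have h : ∫⁻ A in ball (0 : EuclideanSpace ℝ (Fin 3)) Real.pi,
      jacDensity (lie_adStable_specialUnitaryGroup (n := Fin 2))
        (⟨su2Coord A, su2Coord_mem_lie A⟩ : (specialUnitaryLogChart (Fin 2)).lie) =
      ∫⁻ A in ball (0 : EuclideanSpace ℝ (Fin 3)) Real.pi, ENNReal.ofReal (sigmaSU2 ‖A‖ / sigmaSU2 0) :=
    setLIntegral_congr_fun measurableSet_ball fun A _ => jacDensity_pauli A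
  rw [h, lintegral_sigmaRatio_ball_eq Real.pi_pos.le, Real.sin_pi, zero_mul, sub_zero]
  ring_nf

/-- The integral is neither `0` nor `∞`. [cite: Balaban1985UV3, p. 260] -/
theorem lintegral_jacDensity_alcove_pauli_ne_zero_and_ne_top :
    ∫⁻ X in alcove (Fin 2), jacDensity (lie_adStable_specialUnitaryGroup (n := Fin 2)) X
        ∂(Measure.map (fun A : EuclideanSpace ℝ (Fin 3) =>
          (⟨su2Coord A, su2Coord_mem_lie A⟩ : (specialUnitaryLogChart (Fin 2)).lie)) volume) ≠ 0 ∧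
    ∫⁻ X in alcove (Fin 2), jacDensity (lie_adStable_specialUnitaryGroup (n := Fin 2)) X
        ∂(Measure.map (fun A : EuclideanSpace ℝ (Fin 3) =>
          (⟨su2Coord A, su2Coord_mem_lie A⟩ : (specialUnitaryLogChart (Fin 2)).lie)) volume) ≠ ∞ := by
  rw [lintegral_jacDensity_alcove_pauli]
  exact ⟨(ENNReal.ofReal_pos.2 (by positivity)).ne', ENNReal.ofReal_ne_top⟩

/-- The same with p28's EXPLICIT density `Π_j Π_k sinc((θ_j − θ_k)/2)` (`θ(A)` the eigenvalues of `−iA`):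
**`∫_Ω Π_j Π_k sinc((θ_j(A) − θ_k(A))/2) dη_P(A) = 2π²`** — the denominator of p28's
`lintegral_haarProbability_specialUnitaryGroup_eq_prod_sinc` at `N = 2`. [cite: Balaban1985UV3, p. 260]
[cite: Helgason2000, Ch. I §1 Thm. 1.14 (13) p. 96] -/
theorem lintegral_prod_sinc_alcove_pauli :
    ∫⁻ A in alcove (Fin 2), ENNReal.ofReal (∏ j, ∏ k,
        Real.sinc (((isHermitian_neg_I_smul (conjTranspose_eq_neg_of_mem_specialUnitaryLogChart A)).eigenvalues j -
          (isHermitian_neg_I_smul (conjTranspose_eq_neg_of_mem_specialUnitaryLogChart A)).eigenvalues k) / 2))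
        ∂(Measure.map (fun A : EuclideanSpace ℝ (Fin 3) =>
          (⟨su2Coord A, su2Coord_mem_lie A⟩ : (specialUnitaryLogChart (Fin 2)).lie)) volume) =
      ENNReal.ofReal (2 * Real.pi ^ 2) := by
  rw [← lintegral_jacDensity_alcove_pauli]
  refine lintegral_congr fun A => ?_
  rw [HaarDensityUnitaryChart.jacDensity_specialUnitaryLogChart_eq]

end Integral

/-! ## §3  `σ₀ = 1/2π² = σ_{SU(2)}(0)` -/

section Sigma0

variable [MeasurableSpace (specialUnitaryLogChart (Fin 2)).lie] [BorelSpace (specialUnitaryLogChart (Fin 2)).lie]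

/-- **p28's GLOBAL CONSTANT EVALUATED: `σ₀ = dU(SU(2))/∫_Ω |det jac| dη_P = 1/2π²`** (as an `ℝ≥0∞` value), `dU` the
normalised Haar measure, `η_P` Lebesgue measure in the Pauli coordinates.
[cite: Balaban1985UV3, p. 260] [cite: Helgason2000, Ch. I §1 Thm. 1.14 (13) p. 96] -/
theorem coe_sigma0_pauli :
    (sigma0 (Measure.map (fun A : EuclideanSpace ℝ (Fin 3) =>
          (⟨su2Coord A, su2Coord_mem_lie A⟩ : (specialUnitaryLogChart (Fin 2)).lie)) volume)
        (haarProbability (Matrix.specialUnitaryGroup (Fin 2) ℂ)) : ℝ≥0∞) = ENNReal.ofReal (1 / (2 * Real.pi ^ 2)) := by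
  haveI := isAddHaarMeasure_pauli
  haveI : (haarProbability (Matrix.specialUnitaryGroup (Fin 2) ℂ)).IsHaarMeasure := Measure.isHaarMeasure_haarMeasure ⊤
  rw [coe_sigma0, lintegral_jacDensity_alcove_pauli, measure_univ, one_div, one_div,
    ENNReal.ofReal_inv_of_pos (by positivity)]

/-- **`σ₀ = 1/2π²`** as a real number. [cite: Balaban1985UV3, p. 260] [cite: Helgason2000, Ch. I §1 Thm. 1.14 (13) p. 96] -/
theorem sigma0_pauli_eq :
    ((sigma0 (Measure.map (fun A : EuclideanSpace ℝ (Fin 3) =>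
          (⟨su2Coord A, su2Coord_mem_lie A⟩ : (specialUnitaryLogChart (Fin 2)).lie)) volume)
        (haarProbability (Matrix.specialUnitaryGroup (Fin 2) ℂ)) : ℝ≥0) : ℝ) = 1 / (2 * Real.pi ^ 2) := by
  have h := congrArg ENNReal.toReal coe_sigma0_pauli
  rwa [ENNReal.coe_toReal, ENNReal.toReal_ofReal (by positivity)] at h

/-- `σ₀ = 1/2π²` as an `ℝ≥0` number. [cite: Balaban1985UV3, p. 260] -/
theorem sigma0_pauli_eq_toNNReal :
    sigma0 (Measure.map (fun A : EuclideanSpace ℝ (Fin 3) =>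
          (⟨su2Coord A, su2Coord_mem_lie A⟩ : (specialUnitaryLogChart (Fin 2)).lie)) volume)
        (haarProbability (Matrix.specialUnitaryGroup (Fin 2) ℂ)) = (1 / (2 * Real.pi ^ 2)).toNNReal := by
  apply NNReal.coe_injective
  rw [sigma0_pauli_eq, Real.coe_toNNReal _ (by positivity)]

/-- **«σ₀ = σ(0)» BETWEEN THE TWO LINEAGES: p28's `sigma0 η_P dU` IS r07's `σ_{SU(2)}(0)`** (`B10Eq22Rescaling.sigmaSU2`,
the transcription of print's `σ(A) = 1/2π² (sin|A|/|A|)²`). [cite: Balaban1985UV3, p. 260] -/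
theorem sigma0_pauli_eq_sigmaSU2_zero :
    ((sigma0 (Measure.map (fun A : EuclideanSpace ℝ (Fin 3) =>
          (⟨su2Coord A, su2Coord_mem_lie A⟩ : (specialUnitaryLogChart (Fin 2)).lie)) volume)
        (haarProbability (Matrix.specialUnitaryGroup (Fin 2) ℂ)) : ℝ≥0) : ℝ) = sigmaSU2 0 := by
  rw [sigma0_pauli_eq, sigmaSU2_zero]

/-- The `ℝ≥0∞` form of «σ₀ = σ(0)». [cite: Balaban1985UV3, p. 260] -/
theorem coe_sigma0_pauli_eq_ofReal_sigmaSU2_zero :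
    (sigma0 (Measure.map (fun A : EuclideanSpace ℝ (Fin 3) =>
          (⟨su2Coord A, su2Coord_mem_lie A⟩ : (specialUnitaryLogChart (Fin 2)).lie)) volume)
        (haarProbability (Matrix.specialUnitaryGroup (Fin 2) ℂ)) : ℝ≥0∞) = ENNReal.ofReal (sigmaSU2 0) := by
  rw [coe_sigma0_pauli, sigmaSU2_zero]

end Sigma0

/-! ## §4  `coordMeasure η_P dU = (Pauli)_* sigmaMeasure`: the two one-bond coordinate measures are one measure -/

section CoordMeasure

variable [MeasurableSpace (specialUnitaryLogChart (Fin 2)).lie] [BorelSpace (specialUnitaryLogChart (Fin 2)).lie]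

/-- Integration against p28's one-bond coordinate measure at `N = 2`, in Pauli coordinates:
`∫ f d(coordMeasure η_P dU) = ∫_{|A|<π} f(iΣσ_aA^a) σ_{SU(2)}(|A|) d³A` for measurable `f ≥ 0`.
[cite: Balaban1985UV3, p. 260] [cite: Helgason2000, Ch. I §1 Thm. 1.14 (13) p. 96] -/
theorem lintegral_coordMeasure_pauli {f : (specialUnitaryLogChart (Fin 2)).lie → ℝ≥0∞} (hf : Measurable f) :
    ∫⁻ X, f X ∂(coordMeasure (Measure.map (fun A : EuclideanSpace ℝ (Fin 3) =>
          (⟨su2Coord A, su2Coord_mem_lie A⟩ : (specialUnitaryLogChart (Fin 2)).lie)) volume)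
        (haarProbability (Matrix.specialUnitaryGroup (Fin 2) ℂ))) =
      ∫⁻ A in ball (0 : EuclideanSpace ℝ (Fin 3)) Real.pi,
        f ⟨su2Coord A, su2Coord_mem_lie A⟩ * ENNReal.ofReal (sigmaSU2 ‖A‖) := by
  rw [coordMeasure, lintegral_smul_measure, ENNReal.smul_def, smul_eq_mul, coe_sigma0_pauli_eq_ofReal_sigmaSU2_zero,
    lintegral_withDensity_eq_lintegral_mul _ (measurable_jacDensity (lie_adStable_specialUnitaryGroup (n := Fin 2))) hf,
    setLIntegral_map measurableSet_alcove
      ((measurable_jacDensity (lie_adStable_specialUnitaryGroup (n := Fin 2))).mul hf) measurable_pauli,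
    preimage_pauli_alcove, ← lintegral_const_mul' _ _ ENNReal.ofReal_ne_top]
  refine setLIntegral_congr_fun measurableSet_ball fun A _ => ?_
  rw [Pi.mul_apply, jacDensity_pauli, mul_comm (ENNReal.ofReal _) (f _), ← mul_assoc, mul_comm (ENNReal.ofReal _) (f _),
    mul_assoc, ← ENNReal.ofReal_mul (sigmaSU2_zero ▸ by positivity)]
  congr 2
  have h0 : sigmaSU2 0 ≠ 0 := by rw [sigmaSU2_zero]; positivity
  field_simp

/-- **`coordMeasure η_P dU = (Pauli)_* sigmaMeasure`**: p28's `σ₀ • |det jac| dη|_Ω` on `C.lie = 𝔰𝔲(2)` IS r07's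
`σ_{SU(2)}(|A|) 1_{|A|<π} d³A` transported by the Pauli coordinates — print's «σ(A′)dA′» read once in each lineage gives
the same measure. [cite: Balaban1985UV3, p. 260] [cite: Helgason2000, Ch. I §1 Thm. 1.14 (13) p. 96] -/
theorem coordMeasure_pauli_eq_map_sigmaMeasure :
    coordMeasure (Measure.map (fun A : EuclideanSpace ℝ (Fin 3) =>
          (⟨su2Coord A, su2Coord_mem_lie A⟩ : (specialUnitaryLogChart (Fin 2)).lie)) volume)
        (haarProbability (Matrix.specialUnitaryGroup (Fin 2) ℂ)) =
      sigmaMeasure.map (fun A : EuclideanSpace ℝ (Fin 3) =>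
          (⟨su2Coord A, su2Coord_mem_lie A⟩ : (specialUnitaryLogChart (Fin 2)).lie)) := by
  refine Measure.ext_of_lintegral _ fun f hf => ?_
  rw [lintegral_coordMeasure_pauli hf, lintegral_map hf measurable_pauli, lintegral_sigmaMeasure]

end CoordMeasure

/-! ## §5  p28's global theorems at `N = 2` with the constant evaluated; the two routes agree on the whole group -/

section Global

variable [MeasurableSpace (specialUnitaryLogChart (Fin 2)).lie] [BorelSpace (specialUnitaryLogChart (Fin 2)).lie]

/-- **p28's GLOBAL FORMULA AT `N = 2`, CONSTANT EVALUATED: `∫ F dU = (1/2π²) ∫_Ω F(Θ X) |det jac X| dη_P(X)`** for every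
measurable `F ≥ 0` on `SU(2)` — `HaarDensitySpecialUnitaryGlobal.lintegral_haar_specialUnitaryGroup_eq` BY NAME with §2.
[cite: Balaban1985UV3, p. 260] [cite: Helgason2000, Ch. I §1 Thm. 1.14 (13) p. 96] -/
theorem lintegral_haarProbability_su2_eq_alcove {F : Matrix.specialUnitaryGroup (Fin 2) ℂ → ℝ≥0∞} (hF : Measurable F) :
    ∫⁻ g, F g ∂(haarProbability (Matrix.specialUnitaryGroup (Fin 2) ℂ)) =
      ENNReal.ofReal (1 / (2 * Real.pi ^ 2)) *
        ∫⁻ X in alcove (Fin 2), F ((isChartRep_specialUnitaryGroup (n := Fin 2)).expChart X) *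
          jacDensity (lie_adStable_specialUnitaryGroup (n := Fin 2)) X
            ∂(Measure.map (fun A : EuclideanSpace ℝ (Fin 3) =>
              (⟨su2Coord A, su2Coord_mem_lie A⟩ : (specialUnitaryLogChart (Fin 2)).lie)) volume) := by
  haveI := isAddHaarMeasure_pauli
  haveI : (haarProbability (Matrix.specialUnitaryGroup (Fin 2) ℂ)).IsHaarMeasure := Measure.isHaarMeasure_haarMeasure ⊤
  rw [lintegral_haar_specialUnitaryGroup_eq (n := Fin 2) (Measure.map (fun A : EuclideanSpace ℝ (Fin 3) =>
      (⟨su2Coord A, su2Coord_mem_lie A⟩ : (specialUnitaryLogChart (Fin 2)).lie)) volume) (haarProbability _) hF,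
    ← coe_sigma0, coe_sigma0_pauli]

/-- **p28's EXPLICIT-DENSITY FORMULA AT `N = 2`, CONSTANT EVALUATED: `∫ F dU = (1/2π²) ∫_Ω F(e^A) Π_j Π_k
sinc((θ_j(A) − θ_k(A))/2) dη_P(A)`** (`HaarDensitySpecialUnitaryGlobal.lintegral_haarProbability_specialUnitaryGroup_eq_prod_sinc`
BY NAME, its constant `(∫_Ω ΠΠ sinc dη)⁻¹` evaluated by `lintegral_prod_sinc_alcove_pauli`) — [Balaban1985UV3] p. 260 «σ₀
(σ/σ₀)(A′)dA′ … σ₀ = σ(0) = 1/2π²» in the `SU(N)` lineage's own letters at `N = 2`.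
[cite: Balaban1985UV3, p. 260] [cite: Helgason2000, Ch. I §1 Thm. 1.14 (13) p. 96] -/
theorem lintegral_haarProbability_su2_eq_prod_sinc {F : Matrix.specialUnitaryGroup (Fin 2) ℂ → ℝ≥0∞}
    (hF : Measurable F) :
    ∫⁻ g, F g ∂(haarProbability (Matrix.specialUnitaryGroup (Fin 2) ℂ)) =
      ENNReal.ofReal (1 / (2 * Real.pi ^ 2)) *
        ∫⁻ A in alcove (Fin 2), F ((isChartRep_specialUnitaryGroup (n := Fin 2)).expChart A) *
          ENNReal.ofReal (∏ j, ∏ k,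
            Real.sinc (((isHermitian_neg_I_smul (conjTranspose_eq_neg_of_mem_specialUnitaryLogChart A)).eigenvalues j -
              (isHermitian_neg_I_smul (conjTranspose_eq_neg_of_mem_specialUnitaryLogChart A)).eigenvalues k) / 2))
            ∂(Measure.map (fun A : EuclideanSpace ℝ (Fin 3) =>
              (⟨su2Coord A, su2Coord_mem_lie A⟩ : (specialUnitaryLogChart (Fin 2)).lie)) volume) := by
  haveI := isAddHaarMeasure_pauli
  haveI : (haarProbability (Matrix.specialUnitaryGroup (Fin 2) ℂ)).IsHaarMeasure := Measure.isHaarMeasure_haarMeasure ⊤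
  rw [HaarDensitySpecialUnitaryGlobal.lintegral_haarProbability_specialUnitaryGroup_eq_prod_sinc (n := Fin 2)
      (Measure.map (fun A : EuclideanSpace ℝ (Fin 3) =>
        (⟨su2Coord A, su2Coord_mem_lie A⟩ : (specialUnitaryLogChart (Fin 2)).lie)) volume) (haarProbability _) hF,
    lintegral_prod_sinc_alcove_pauli, one_div, ENNReal.ofReal_inv_of_pos (by positivity)]

/-- **THE TWO ROUTES AGREE ON THE WHOLE GROUP**: p28's global formula at `N = 2` (§2–§3), transported to print's ball by
§1, IS r07's `∫ F dU = ∫_{|A|<π} F(exp iA) σ_{SU(2)}(|A|) d³A` (`B10Eq18SigmaSU2Haar.lintegral_haarProbability_eq_pauli`) —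
here RE-DERIVED through the `SU(N)` lineage (r07 g19's `B10Eq18SigmaSU2Chart` reached the windows `s ≤ log(4/3)` only).
[cite: Balaban1985UV3, p. 260] [cite: Helgason2000, Ch. I §1 Thm. 1.14 (13) p. 96] -/
theorem lintegral_haarProbability_su2_eq_pauli_of_alcove {F : Matrix.specialUnitaryGroup (Fin 2) ℂ → ℝ≥0∞}
    (hF : Measurable F) :
    ∫⁻ g, F g ∂(haarProbability (Matrix.specialUnitaryGroup (Fin 2) ℂ)) =
      ∫⁻ A in ball (0 : EuclideanSpace ℝ (Fin 3)) Real.pi, F (expPauli A) * ENNReal.ofReal (sigmaSU2 ‖A‖) := by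
  have hmeas : Measurable fun X : (specialUnitaryLogChart (Fin 2)).lie =>
      F ((isChartRep_specialUnitaryGroup (n := Fin 2)).expChart X) *
        jacDensity (lie_adStable_specialUnitaryGroup (n := Fin 2)) X :=
    (hF.comp (isChartRep_specialUnitaryGroup (n := Fin 2)).measurable_expChart).mul
      (measurable_jacDensity (lie_adStable_specialUnitaryGroup (n := Fin 2)))
  rw [lintegral_haarProbability_su2_eq_alcove hF, setLIntegral_map measurableSet_alcove hmeas measurable_pauli,
    preimage_pauli_alcove, ← lintegral_const_mul' _ _ ENNReal.ofReal_ne_top]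
  refine setLIntegral_congr_fun measurableSet_ball fun A _ => ?_
  rw [expChart_pauli, jacDensity_pauli, ← mul_assoc, mul_comm (ENNReal.ofReal _) (F _), mul_assoc,
    ← ENNReal.ofReal_mul (by positivity)]
  congr 2
  have h0 : sigmaSU2 0 ≠ 0 := by rw [sigmaSU2_zero]; positivity
  rw [← sigmaSU2_zero]
  field_simp

/-- **p28's `Θ_*(coordMeasure) = dU` AT `N = 2` IS r07's `(exp i·)_* sigmaMeasure = dU`**: the measure-preserving chart of
`HaarDensitySpecialUnitaryGlobalPi` (`map_expChart_coordMeasure`), read through §4 and `Θ ∘ Pauli = expPauli`, gives back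
`B10Eq18SigmaSU2Haar.map_expPauli_sigmaMeasure` — derived here from the `SU(N)` lineage.
[cite: Balaban1985UV3, p. 260] [cite: Helgason2000, Ch. I §1 Thm. 1.14 (13) p. 96] -/
theorem map_expPauli_sigmaMeasure_of_coordMeasure :
    sigmaMeasure.map expPauli = haarProbability (Matrix.specialUnitaryGroup (Fin 2) ℂ) := by
  haveI := isAddHaarMeasure_pauli
  haveI : (haarProbability (Matrix.specialUnitaryGroup (Fin 2) ℂ)).IsHaarMeasure := Measure.isHaarMeasure_haarMeasure ⊤
  have h := map_expChart_coordMeasure (n := Fin 2) (Measure.map (fun A : EuclideanSpace ℝ (Fin 3) =>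
      (⟨su2Coord A, su2Coord_mem_lie A⟩ : (specialUnitaryLogChart (Fin 2)).lie)) volume)
    (haarProbability (Matrix.specialUnitaryGroup (Fin 2) ℂ))
  rw [coordMeasure_pauli_eq_map_sigmaMeasure, Measure.map_map (isChartRep_specialUnitaryGroup (n := Fin 2)).measurable_expChart
    measurable_pauli, expChart_comp_pauli] at h
  exact h

end Global

end Literature.MathematicalPhysics.QuantumFieldTheory.Balaban1983to89.Sigma0SU2TwinBridge

end
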